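import Summits.CriticalPhenomena.Ising3DConformalLimit.Theorems.EnergyNotSigmaSquaredMoebiusLimitExistsOrbitLiouvilleFlowAlgebra
import Summits.CriticalPhenomena.Ising3DConformalLimit.Theorems.EnergyNotSigmaSquaredMoebiusLimitExistsHrpFactorisation
import Literature.Algebra.EuclideanLattices.FccBccLattices
import HarnessLib

/-!
# Line `Sketch` (§1 complex-circle-rotation-liouville) for crux `MoebiusLimitExists` — dictionary / tightness of the bet S4

Crux stmt-CriticalPhenomena-1344 (`Theses.PerfectScreening.MoebiusLimitExists` = `Theses.EnergyNotSigmaSquared.MoebiusLimit`).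
The line's one open stub S4 `stub_orbitEntire_of_limit` says: every normalised, non-degenerate,
translation-invariant, scale-covariant pointwise limit of the critical `ℤ³` correlators has tempered-entire
weighted orbit functions along the elliptic Möbius flow `h_ψ = ellipticFlow ψ` (`OrbitEntire`). This file
SIZES that stub, kernel-checked:

* `ellipticFlow_eq_generators` — THE FLOW AS A WORD IN THE MÖBIUS GENERATORS: for `cos ψ ≠ 1` and `y` off the
  `x₂`-axis, `h_ψ(y) = −p_ψ + λ_ψ • R₃ (ι (y − p_ψ))` with the pole `p_ψ = cot(ψ/2) e₂ = (sin ψ / (1 − cos ψ)) e₂`,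
  the scale `λ_ψ = 2 / (1 − cos ψ)`, `ι` the unit inversion and `R₃ = flipThree`; and the weight identity
  `D(y, ψ) = (1 − cos ψ) ‖y − p_ψ‖²` (`flowDen_eq_pole`), i.e. `2 / D = λ_ψ / ‖y − p_ψ‖²` is exactly the conformal
  factor of that word.
* `orbitFun_eq_of_moebius` — hence for a MÖBIUS-COVARIANT family the weighted orbit function is CONSTANT,
  `F_x(ψ) = S n x` (translation, scale, `R₃`, inversion covariance applied along the word), and
  `orbitEntire_of_moebius : IsMoebiusCovariant Δ S → OrbitEntire Δ S` (take `F` constant).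
* `stub_orbitEntire_of_items` — S4 follows from items stmt-1980 (`LimitRotationInvariant`) ∧ stmt-1982
  (`InversionUpgradeNormalised`) outright (with the tree theorem `HRP2Rigidity_of`), and
  `stub_orbitEntire_of_crux` — S4 is CRUX-IMPLIED (`MoebiusLimitExists_iff_hrp`, p114842).

Together with the skeleton (`Cruxes/MoebiusLimitExists/Lines/Sketch.lean`: 1981 ∧ S4 ⇒ crux, through the landed
stubs S1 p128155, S2 p128058, S3a p128039, S3b p128083) this gives, given item 1981, `S4 ⟺ crux ⟺ 1980 ∧ 1982`:
the stub carries exactly the conformal-covariance content of the 3D Ising scaling limit — the line's honest residual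
is the DOMAIN OF HOLOMORPHY of one `2π`-periodic function of one complex variable per configuration.

References: Di Francesco–Mathieu–Sénéchal 1997 §4.1 (generators of the conformal group, special conformal
transformations as translation conjugated by inversion, eq. (4.16)), §4.3.1 eq. (4.62); elliptic one-parameter
subgroups: Benedetti–Petronio 1992, ch. A.
-/

noncomputable section

open Set Function Filter EuclideanGeometry
open scoped Topology
open Literature.Probability.LatticeModels

namespace Summit.CriticalPhenomena.Ising3DConformalLimit.MoebiusLimitExistsOrbitLiouville

/-! ### The flow as a word in the generators -/

/-- The pole parameter `k_ψ = sin ψ / (1 − cos ψ)` (`= cot (ψ/2)`): `h_ψ` sends the axis point `k_ψ e₂` to `∞`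
and `∞` to `−k_ψ e₂`. [folklore] -/
def poleParam (ψ : ℝ) : ℝ := Real.sin ψ / (1 - Real.cos ψ)

/-- The pole `p_ψ = k_ψ e₂` of `h_ψ` (on the `x₂`-axis). [folklore] -/
def flowPole (ψ : ℝ) : EuclideanSpace ℝ (Fin 3) := EuclideanSpace.single 2 (poleParam ψ)

/-- The scale `λ_ψ = 2 / (1 − cos ψ)` of `h_ψ`. [folklore] -/
def flowScale (ψ : ℝ) : ℝ := 2 / (1 - Real.cos ψ)

/-- Coordinates of the pole. [folklore] -/
theorem flowPole_apply (ψ : ℝ) (j : Fin 3) :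
    flowPole ψ j = if j = 2 then poleParam ψ else 0 := by
  simp [flowPole]

/-- `1 − cos ψ > 0` when `cos ψ ≠ 1`. [folklore] -/
theorem one_sub_cos_pos {ψ : ℝ} (hψ : Real.cos ψ ≠ 1) : 0 < 1 - Real.cos ψ :=
  sub_pos.2 (lt_of_le_of_ne (Real.cos_le_one ψ) hψ)

/-- The key trigonometric identities of the pole parameter: `k (1 − cos ψ) = sin ψ` and
`k sin ψ = 1 + cos ψ`. [folklore] -/
theorem poleParam_mul {ψ : ℝ} (hψ : Real.cos ψ ≠ 1) :
    poleParam ψ * (1 - Real.cos ψ) = Real.sin ψ ∧ poleParam ψ * Real.sin ψ = 1 + Real.cos ψ := by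
  have h := one_sub_cos_pos hψ
  refine ⟨by rw [poleParam, div_mul_cancel₀ _ h.ne'], ?_⟩
  rw [poleParam, div_mul_eq_mul_div, div_eq_iff h.ne']
  linear_combination Real.sin_sq_add_cos_sq ψ

/-- Coordinates of `y − p_ψ`. [folklore] -/
theorem sub_flowPole_apply (y : EuclideanSpace ℝ (Fin 3)) (ψ : ℝ) :
    (y - flowPole ψ) 0 = y 0 ∧ (y - flowPole ψ) 1 = y 1 ∧ (y - flowPole ψ) 2 = y 2 - poleParam ψ := by
  simp [flowPole_apply]

/-- **Weight identity**: `D(y, ψ) = (1 − cos ψ) · ‖y − p_ψ‖²` (so `2 / D(y,ψ) = λ_ψ / ‖y − p_ψ‖²`, the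
conformal factor of `y ↦ −p_ψ + λ_ψ R₃ ι (y − p_ψ)` at `y`). [cite: FrancescoMathieuSenechal1997, §4.1 eq. (4.16)] -/
theorem flowDen_eq_pole (y : EuclideanSpace ℝ (Fin 3)) {ψ : ℝ} (hψ : Real.cos ψ ≠ 1) :
    flowDen y ψ = (1 - Real.cos ψ) * ‖y - flowPole ψ‖ ^ 2 := by
  obtain ⟨hk1, hk2⟩ := poleParam_mul hψ
  obtain ⟨e0, e1, e2⟩ := sub_flowPole_apply y ψ
  rw [flowDen, Literature.Algebra.EuclideanLattices.norm_sq_fin_three, Literature.Algebra.EuclideanLattices.norm_sq_fin_three, e0, e1, e2]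
  set k := poleParam ψ
  have : (1 - Real.cos ψ) * (y 2 - k) ^ 2 =
      (1 - Real.cos ψ) * y 2 ^ 2 - 2 * y 2 * Real.sin ψ + (1 + Real.cos ψ) := by
    have e : (1 - Real.cos ψ) * (y 2 - k) ^ 2 =
        (1 - Real.cos ψ) * y 2 ^ 2 - 2 * y 2 * (k * (1 - Real.cos ψ)) + k * (k * (1 - Real.cos ψ)) := by ring
    rw [e, hk1, hk2]
  linear_combination (-1 : ℝ) * this

/-- Off the `x₂`-axis, `y − p_ψ ≠ 0`. [folklore] -/
theorem sub_flowPole_ne_zero {y : EuclideanSpace ℝ (Fin 3)} (hy : y 0 ≠ 0 ∨ y 1 ≠ 0) (ψ : ℝ) :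
    y - flowPole ψ ≠ 0 := by
  obtain ⟨e0, e1, -⟩ := sub_flowPole_apply y ψ
  intro h
  rcases hy with h0 | h1
  · exact h0 (by rw [← e0, h]; rfl)
  · exact h1 (by rw [← e1, h]; rfl)

/-- **The elliptic flow as a word in the Möbius generators**: for `cos ψ ≠ 1` and `y` off the `x₂`-axis,
`h_ψ(y) = −p_ψ + λ_ψ • R₃ (ι (y − p_ψ))`. [cite: FrancescoMathieuSenechal1997, §4.1 eq. (4.16)] -/
theorem ellipticFlow_eq_generators (y : EuclideanSpace ℝ (Fin 3)) {ψ : ℝ} (hψ : Real.cos ψ ≠ 1)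
    (hy : y 0 ≠ 0 ∨ y 1 ≠ 0) :
    ellipticFlow ψ y = -flowPole ψ + flowScale ψ • flipThree (inversion 0 1 (y - flowPole ψ)) := by
  have h1c := one_sub_cos_pos hψ
  obtain ⟨hk1, hk2⟩ := poleParam_mul hψ
  have hD : flowDen y ψ = (1 - Real.cos ψ) * ‖y - flowPole ψ‖ ^ 2 := flowDen_eq_pole y hψ
  have hv : y - flowPole ψ ≠ 0 := sub_flowPole_ne_zero hy ψ
  have hn : 0 < ‖y - flowPole ψ‖ ^ 2 := pow_pos (norm_pos_iff.2 hv) 2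
  have hDpos : 0 < flowDen y ψ := by rw [hD]; positivity
  obtain ⟨e0, e1, e2⟩ := sub_flowPole_apply y ψ
  rw [MoebiusLimitExistsOneMapOneJet.inversion_zero_one_eq_smul, map_smul]
  -- compare coordinates
  ext j
  simp only [ellipticFlow, flowNum, PiLp.smul_apply, PiLp.add_apply, PiLp.neg_apply, smul_eq_mul,
    flipThree_apply, flowPole_apply]
  have hnorm : ‖y - flowPole ψ‖ ^ 2 = flowDen y ψ / (1 - Real.cos ψ) := by
    rw [hD]; field_simp
  fin_cases j
  · simp only [Fin.zero_eta, Fin.isValue, Matrix.cons_val_zero, show (0 : Fin 3) ≠ 2 by decide,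
      if_false, e0, hnorm, flowScale]
    field_simp
    ring
  · simp only [Fin.mk_one, Fin.isValue, Matrix.cons_val_one, Matrix.cons_val_zero,
      show (1 : Fin 3) ≠ 2 by decide, if_false, e1, hnorm, flowScale]
    field_simp
    ring
  · simp only [Fin.reduceFinMk, Fin.isValue, Matrix.cons_val, if_true, e2, hnorm, flowScale]
    rw [inv_mul_eq_div, div_eq_iff hDpos.ne']
    field_simp
    rw [flowDen, Literature.Algebra.EuclideanLattices.norm_sq_fin_three]
    set k := poleParam ψ
    linear_combination (y 0 ^ 2 + y 1 ^ 2 + y 2 ^ 2 - 1) * hk1 - (2 * y 2) * hk2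


/-! ### Möbius covariance forces constant orbit functions -/

/-- At an angle with `cos ψ = 1` (so `sin ψ = 0`) the flow is the identity and every weight is `1`, so
`F_x(ψ) = S n x` for ANY family. [folklore] -/
theorem orbitFun_eq_of_cos_eq_one (Δ : ℝ) (S : CorrFamily 3) (n : ℕ) (x : Fin n → EuclideanSpace ℝ (Fin 3))
    {ψ : ℝ} (hψ : Real.cos ψ = 1) : orbitFun Δ S n x ψ = S n x := by
  have hsin : Real.sin ψ = 0 := Real.sin_eq_zero_iff_cos_eq.2 (Or.inl hψ)
  have hD : ∀ y : EuclideanSpace ℝ (Fin 3), flowDen y ψ = flowDen y 0 := fun y => by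
    simp only [flowDen, hψ, hsin, Real.sin_zero, Real.cos_zero]
  have hN : ∀ y : EuclideanSpace ℝ (Fin 3), flowNum y ψ = flowNum y 0 := fun y => by
    simp only [flowNum, hψ, hsin, Real.sin_zero, Real.cos_zero]
  have hflow : ∀ y : EuclideanSpace ℝ (Fin 3), ellipticFlow ψ y = y := fun y => by
    have e : ellipticFlow ψ y = ellipticFlow 0 y := by simp only [ellipticFlow, hD, hN]
    rw [e, ellipticFlow_zero_apply]
  simp only [orbitFun, orbitWeight, hD, flowDen_at_zero, hflow, (div_self two_ne_zero : (2 : ℝ) / 2 = 1),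
    Real.one_rpow, Finset.prod_const_one, one_mul]

/-- **For a Möbius-covariant family the weighted orbit function is constant**, `F_x(ψ) = S n x`, at every
configuration off the `x₂`-axis and every real angle: apply translation invariance, scale covariance
(`λ_ψ`), `R₃`-invariance and inversion covariance along the word `h_ψ = −p_ψ + λ_ψ R₃ ι (· − p_ψ)`; the
weights `(2/D)^Δ = λ_ψ^Δ ‖xᵢ − p_ψ‖^{-2Δ}` cancel the covariance factors exactly.
[cite: FrancescoMathieuSenechal1997, §4.3.1 eq. (4.62)] -/
theorem orbitFun_eq_of_moebius {Δ : ℝ} {S : CorrFamily 3} (hM : IsMoebiusCovariant Δ S) {n : ℕ}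
    {x : Fin n → EuclideanSpace ℝ (Fin 3)} (hx : ∀ i, x i 0 ≠ 0 ∨ x i 1 ≠ 0) (ψ : ℝ) :
    orbitFun Δ S n x ψ = S n x := by
  obtain ⟨⟨htr, hrot⟩, hsc, hinv⟩ := hM
  by_cases hψ : Real.cos ψ = 1
  · exact orbitFun_eq_of_cos_eq_one Δ S n x hψ
  have h1c := one_sub_cos_pos hψ
  have hlam : 0 < flowScale ψ := div_pos two_pos h1c
  have hv : ∀ i, x i - flowPole ψ ≠ 0 := fun i => sub_flowPole_ne_zero (hx i) ψ
  -- the flow configuration as a word in the generators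
  have hflow : (fun i => ellipticFlow ψ (x i)) =
      fun i => flowScale ψ • flipThree (inversion 0 1 (x i - flowPole ψ)) + -flowPole ψ := by
    funext i
    rw [ellipticFlow_eq_generators (x i) hψ (hx i), add_comm]
  have hsub : (fun i => x i - flowPole ψ) = fun i => x i + -flowPole ψ := by
    funext i; rw [sub_eq_add_neg]
  -- covariance along the word
  have hS : S n (fun i => ellipticFlow ψ (x i)) =
      flowScale ψ ^ (-(n : ℝ) * Δ) * ((∏ i, ‖x i - flowPole ψ‖ ^ (2 * Δ)) * S n x) := by
    rw [hflow, htr n (-flowPole ψ) (fun i => flowScale ψ • flipThree (inversion 0 1 (x i - flowPole ψ))),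
      hsc n (flowScale ψ) hlam (fun i => flipThree (inversion 0 1 (x i - flowPole ψ))),
      hrot n flipThree (fun i => inversion 0 1 (x i - flowPole ψ)), hinv n (fun i => x i - flowPole ψ) hv,
      hsub, htr n (-flowPole ψ) x]
  -- the weights
  have hfac : ∀ i, (2 / flowDen (x i) ψ) ^ Δ = flowScale ψ ^ Δ * (‖x i - flowPole ψ‖ ^ (2 * Δ))⁻¹ := by
    intro i
    have hq : 2 / flowDen (x i) ψ = flowScale ψ * (‖x i - flowPole ψ‖ ^ 2)⁻¹ := by
      rw [flowDen_eq_pole (x i) hψ, flowScale]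
      field_simp
    rw [hq, Real.mul_rpow hlam.le (inv_nonneg.2 (sq_nonneg _)), Real.inv_rpow (sq_nonneg _),
      ← Real.rpow_two, ← Real.rpow_mul (norm_nonneg _)]
  have hw : orbitWeight Δ n x ψ =
      flowScale ψ ^ ((n : ℝ) * Δ) * (∏ i, ‖x i - flowPole ψ‖ ^ (2 * Δ))⁻¹ := by
    simp only [orbitWeight, hfac, Finset.prod_mul_distrib, Finset.prod_const, Finset.card_univ,
      Fintype.card_fin, Finset.prod_inv_distrib]
    rw [← Real.rpow_mul_natCast hlam.le, mul_comm Δ]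
  have hP : (∏ i, ‖x i - flowPole ψ‖ ^ (2 * Δ)) ≠ 0 :=
    (Finset.prod_pos fun i _ => Real.rpow_pos_of_pos (norm_pos_iff.2 (hv i)) _).ne'
  have hll : flowScale ψ ^ ((n : ℝ) * Δ) * flowScale ψ ^ (-(n : ℝ) * Δ) = 1 := by
    rw [← Real.rpow_add hlam, neg_mul, add_neg_cancel, Real.rpow_zero]
  rw [orbitFun, hw, hS]
  calc flowScale ψ ^ ((n : ℝ) * Δ) * (∏ i, ‖x i - flowPole ψ‖ ^ (2 * Δ))⁻¹ *
        (flowScale ψ ^ (-(n : ℝ) * Δ) * ((∏ i, ‖x i - flowPole ψ‖ ^ (2 * Δ)) * S n x))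
      = (flowScale ψ ^ ((n : ℝ) * Δ) * flowScale ψ ^ (-(n : ℝ) * Δ)) *
          ((∏ i, ‖x i - flowPole ψ‖ ^ (2 * Δ))⁻¹ * (∏ i, ‖x i - flowPole ψ‖ ^ (2 * Δ))) * S n x := by ring
    _ = S n x := by rw [hll, inv_mul_cancel₀ hP, one_mul, one_mul]

/-- **Tightness of the bet: Möbius covariance ⇒ ORBIT-ENTIRE** (take `F ≡ S n x`, an entire function of
growth order `0`). [cite: FrancescoMathieuSenechal1997, §4.3.1 eq. (4.62)] -/
theorem orbitEntire_of_moebius {Δ : ℝ} {S : CorrFamily 3} (hM : IsMoebiusCovariant Δ S) :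
    OrbitEntire Δ S := by
  intro n x hx
  refine ⟨fun _ => (S n x : ℂ), differentiable_const _, ⟨‖(S n x : ℂ)‖, 0, fun z => ?_⟩, fun ψ => ?_⟩
  · rw [pow_zero, mul_one]
  · rw [orbitFun_eq_of_moebius hM hx.2 ψ]

/-- **Möbius covariance ⇒ ORBIT-ENTIRE**, fully quantified form (registered anchor of this dictionary
file on the crux item). [cite: FrancescoMathieuSenechal1997, §4.3.1 eq. (4.62)] -/
theorem orbitEntire_of_moebiusCovariant :
    ∀ (Δ : ℝ) (S : CorrFamily 3), IsMoebiusCovariant Δ S → OrbitEntire Δ S :=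
  fun _ _ hM => orbitEntire_of_moebius hM

/-! ### The bet S4 is implied by items 1980 ∧ 1982, hence by the crux -/

/-- **S4 ⟸ items stmt-1980 ∧ stmt-1982**: under `LimitRotationInvariant` (with the tree theorem
`HRP2Rigidity_of`) and `InversionUpgradeNormalised`, every normalised, non-degenerate,
translation-invariant, scale-covariant limit is Möbius covariant, hence orbit-entire. The statement proved
is VERBATIM the registered stub `stub_orbitEntire_of_limit` of the line, with the two items as hypotheses.
[cite: DuminilCopinICM2022, §8.1 p. 25 and §8.4 p. 29] -/
theorem stub_orbitEntire_of_items
    (h1980 : Theses.HyperoctahedralRP.LimitRotationInvariant)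
    (h1982 : Theses.HyperoctahedralRP.InversionUpgradeNormalised) :
    ∀ (ρ : ℝ → ℝ) (Δ : ℝ) (S : CorrFamily 3), (∀ δ ∈ Set.Ioc (0:ℝ) 1, 0 < ρ δ) → 0 < Δ →
      HasPointwiseScalingLimit (criticalCorr 3) ρ S →
      (∀ n z, z ∉ NonCoincident 3 n → S n z = 0) → IsNondegenerateTwoPoint S →
      IsTranslationInvariant S → IsScaleCovariant Δ S → OrbitEntire Δ S := by
  intro ρ Δ S hρ _ hlim hnorm hnd htr hsc
  have hrot : IsRotationInvariant S :=
    h1980 Cruxes.HRP2Rigidity.XRayMellin.HRP2Rigidity_of ρ Δ S hρ hlim hnorm hnd htr hsc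
  have hinv : IsInversionCovariant Δ S := h1982 ρ Δ S hρ hlim hnorm hnd ⟨htr, hrot⟩ hsc
  exact orbitEntire_of_moebius ⟨⟨htr, hrot⟩, hsc, hinv⟩

/-- **S4 IS CRUX-IMPLIED**: the crux gives items 1980 and 1982 (`MoebiusLimitExists_iff_hrp`, p114842:
any two non-degenerate limits are proportional order by order), hence S4. With the line's skeleton
(`1981 ∧ S4 ⇒ crux`) this sizes the bet exactly: given item 1981, `S4 ⟺ crux ⟺ 1980 ∧ 1982`.
[cite: DuminilCopinICM2022, §8.1 p. 25 and §8.4 p. 29] -/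
theorem stub_orbitEntire_of_crux (h : Theses.PerfectScreening.MoebiusLimitExists) :
    ∀ (ρ : ℝ → ℝ) (Δ : ℝ) (S : CorrFamily 3), (∀ δ ∈ Set.Ioc (0:ℝ) 1, 0 < ρ δ) → 0 < Δ →
      HasPointwiseScalingLimit (criticalCorr 3) ρ S →
      (∀ n z, z ∉ NonCoincident 3 n → S n z = 0) → IsNondegenerateTwoPoint S →
      IsTranslationInvariant S → IsScaleCovariant Δ S → OrbitEntire Δ S :=
  stub_orbitEntire_of_items (MoebiusLimitExistsOnlyInteraction.limitRotationInvariant_of_MoebiusLimitExists h)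
    (MoebiusLimitExistsOnlyInteraction.inversionUpgradeNormalised_of_MoebiusLimitExists h)

end Summit.CriticalPhenomena.Ising3DConformalLimit.MoebiusLimitExistsOrbitLiouville

end
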